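import Literature.NumberTheory.K2Lit.DoublingEmbedding
import Literature.NumberTheory.Automorphic.UnitaryGroupAdelicProduct
import Literature.NumberTheory.Automorphic.QuadraticAdeleBaseChange
import HarnessLib

/-!
# The doubling embedding at a finite place: `ι_v : G(F_v) × G(F_v) ↪ H(F_v) = U(𝕎 ⊕ 𝕎⁻)(F_v)` and its
# compatibility with the adelic `ι` (leaf D7a of the LOCAL SEAM of s23)

Topic `NumberTheory/K2Lit` (Track B build stream 29; DEPMAP v2.1 `Cruxes/HLiu418/Lines/K2_Liu_LocalSeam_s23.md` §2 (LS1) ∕ §3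
file #22 «`iotaLoc_v`, compatibility with ★ `iotaV`»; LEAD «M-154r» Q2: DEFS leaf, owner K2Liu). The LOCAL twin of ★
`K2Lit/DoublingEmbedding` (`iotaGG`, `iotaV`, `iotaLeft` over `𝔸_L`): the same generic terms (★ `UnitaryGroup.reindexU`, ★
`UnitaryGroup.blockDiag`, ★ `toNegForm`, ★ `UnitaryGroup.dualPairInl`) over the local ring `L_v = Π_{w ∣ v} L_w` (★
`UnitaryGroup.LocalRing`, conjugation ★ `conjLocal`) and over the finite adele ring (★ `conjFiniteAdele`). Plumbing
definitions with bodies and proved theorems only: **no `sorry`, no named fact, no instance, no notation.**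

Setting of ★ `DoublingEmbedding`: CM field `L`, `V = diag dV` (rank `N`), `W = diag dW` (rank `M`), `e : Fin N × Fin M ≃ Fin n`,
`H = U(J^𝔻)`, `J^𝔻 = ★ hermD L e dV hdV dW hdW`, `v` a finite place of `L⁺ = ★ Fp L`.

* §1 `pairFormLoc v`, `localForm_hermD_eq v` — the local form matrix of `J^𝔻` at `v` is `reindex e₂ e₂ ((reindex e e 𝕁_v) ⊕ (−…))`,
  `𝕁_v = (J_V ⊗ 1)_v ⊗ₖ (J_W ⊗ 1)_v` (★ `adelicForm_hermD_eq` pushed through ★ `adeleToLocal`); the same over `𝔸_f`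
  (`pairFormFin`, `finiteAdelicForm_hermD_eq`).
* §2 `iotaGGLoc v : G₁(F_v) × G₁(F_v) →* H(F_v)` (matrix forms ★ `«local»`), `iotaVLoc v : U(V)(F_v) × U(V)(F_v) →* H(F_v)`,
  `iotaLeftLoc v`; their matrices (`coe_…`, `rfl`), continuity.
* §3 **compatibility with the adelic `ι`**: `toLocal_iotaV : (ι(g₁, g₂))_v = ι_v((g₁)_v, (g₂)_v)` (★ `UnitaryGroup.toLocal`).
* §4 the factor forms ★ `localPi` (through ★ `localPiEquiv`): `iotaVLocPi v : localPi … N (diag dV) v × localPi … N (diag dV) v →*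
  localPi … (n + n) J^𝔻 v`, `iotaLeftLocPi v` (the argument of the local section in `Λ_{s,v}(g) = f_{s,v}(ι_v(g, 1))` and in the
  local zeta integral), continuity, `localPiEquiv_iotaVLocPi`.
* §5 the finite-adelic `ι_f` (`iotaVFin`), `finPart_iotaV : (ι(g₁, g₂))_f = ι_f((g₁)_f, (g₂)_f)` and
  `evalPlace_iotaVFin : (ι_f(h₁, h₂))_v = ι_v((h₁)_v, (h₂)_v)` — what the place-by-place bookkeeping of the local seam
  (#27–#29: `Z(s) = (∏_{v∉S} c_v(s))·Z_S(s)`) reads.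

References: I. Piatetski-Shapiro, S. Rallis, *L-functions for the classical groups*, LNM 1254 (1987) §1 [PSR87 — cited as
GelbartPiatetskishapiroRallis1987]; M. Harris, S. Kudla, W. J. Sweet, JAMS 9 (1996) §1 (1.11) [HarrisKudlaSweet1996]; Y. Liu,
ANT 5 (2011) §2C p. 863 (the local zeta integrals `Z_v`) [Liu2011]; J.-S. Li, J. reine angew. Math. 428 (1992) §3 [Li1992].
-/

set_option autoImplicit false

noncomputable section

open scoped Matrix Kronecker
open NumberField IsDedekindDomain

namespace Literature.NumberTheory.K2Lit.SiegelDoubled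

open Literature.NumberTheory.Automorphic Literature.NumberTheory.GaloisRepresentations
open Literature.NumberTheory.GelbartRogawski1991 Literature.NumberTheory.GelbartRogawski1991.GRConstruction

variable (L : Type) [Field L] [NumberField L] [IsCMField L]
variable {N M n : ℕ} (e : Fin N × Fin M ≃ Fin n)
  (dV : Fin N → L) (hdV : ∀ i, IsCMField.complexConj L (dV i) = dV i)
  (dW : Fin M → L) (hdW : ∀ i, IsCMField.complexConj L (dW i) = dW i)
  (v : HeightOneSpectrum (𝓞 (Fp L)))

/-! ## §1 The local and finite-adelic form matrices of `J^𝔻` -/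

/-- the local pair form `(J_V ⊗ 1)_v ⊗ₖ (J_W ⊗ 1)_v ∈ M_{N M}(L_v)`, `L_v = Π_{w ∣ v} L_w` — the form of `G₁(F_v) = U(V ⊗ W)(F_v)`.
[cite: HarrisKudlaSweet1996, §1 (1.11)] -/
abbrev pairFormLoc : Matrix (Fin N × Fin M) (Fin N × Fin M) (UnitaryGroup.LocalRing L v) :=
  (UnitaryGroup.adelicForm L N (Matrix.diagonal dV)).map (UnitaryGroup.adeleToLocal L v) ⊗ₖ
    (UnitaryGroup.adelicForm L M (Matrix.diagonal dW)).map (UnitaryGroup.adeleToLocal L v)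

omit [IsCMField L] in
/-- `(pairFormA)_v = pairFormLoc v` (Kronecker products commute with ring homomorphisms). [cite: HarrisKudlaSweet1996, §1 (1.11)] -/
theorem pairFormA_map_adeleToLocal :
    (pairFormA L dV dW).map (UnitaryGroup.adeleToLocal L v) = pairFormLoc L dV dW v :=
  (UnitaryGroup.kronecker_map_map _ _ _).symm

/-- **the local form matrix of `J^𝔻` at `v`** is the re-enumerated block form `(reindex e e 𝕁_v) ⊕ (−reindex e e 𝕁_v)` (★
`adelicForm_hermD_eq` at the place `v`). [cite: HarrisKudlaSweet1996, §1 (1.9)] -/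
theorem localForm_hermD_eq :
    (UnitaryGroup.adelicForm L (n + n) (hermD L e dV hdV dW hdW)).map (UnitaryGroup.adeleToLocal L v) =
      Matrix.reindex (e₂ (n := n)) (e₂ (n := n))
        (Matrix.fromBlocks (Matrix.reindex e e (pairFormLoc L dV dW v)) 0 0
          (-Matrix.reindex e e (pairFormLoc L dV dW v))) := by
  rw [adelicForm_hermD_eq, UnitaryGroup.reindex_map, Matrix.fromBlocks_map, UnitaryGroup.reindex_map,
    Matrix.map_zero _ (map_zero _), Matrix.map_neg _ (fun a => map_neg _ a), UnitaryGroup.reindex_map,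
    pairFormA_map_adeleToLocal]

/-- the finite-adelic pair form `(J_V ⊗ 1)_f ⊗ₖ (J_W ⊗ 1)_f ∈ M_{N M}(𝔸_{L,f})`. [cite: HarrisKudlaSweet1996, §1 (1.11)] -/
abbrev pairFormFin : Matrix (Fin N × Fin M) (Fin N × Fin M) (FiniteAdeleRing (𝓞 L) L) :=
  UnitaryGroup.finiteAdelicForm L N (Matrix.diagonal dV) ⊗ₖ UnitaryGroup.finiteAdelicForm L M (Matrix.diagonal dW)

omit [IsCMField L] in
/-- `(adelicForm J)_f = finiteAdelicForm J` (second adelic component of a principal adele). [cite: PlatonovRapinchuk1994, §5.1] -/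
theorem adelicForm_map_snd {K : ℕ} (J : Matrix (Fin K) (Fin K) L) :
    (UnitaryGroup.adelicForm L K J).map (UnitaryGroup.adeleSnd L) = UnitaryGroup.finiteAdelicForm L K J := by
  rw [UnitaryGroup.adelicForm, UnitaryGroup.finiteAdelicForm, Matrix.map_map]
  rfl

/-- **the finite-adelic form matrix of `J^𝔻`** is `reindex e₂ e₂ ((reindex e e 𝕁_f) ⊕ (−reindex e e 𝕁_f))`.
[cite: HarrisKudlaSweet1996, §1 (1.9)] -/
theorem finiteAdelicForm_hermD_eq :
    UnitaryGroup.finiteAdelicForm L (n + n) (hermD L e dV hdV dW hdW) =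
      Matrix.reindex (e₂ (n := n)) (e₂ (n := n))
        (Matrix.fromBlocks (Matrix.reindex e e (pairFormFin L dV dW)) 0 0 (-Matrix.reindex e e (pairFormFin L dV dW))) := by
  rw [← adelicForm_map_snd, adelicForm_hermD_eq, UnitaryGroup.reindex_map, Matrix.fromBlocks_map, UnitaryGroup.reindex_map,
    Matrix.map_zero _ (map_zero _), Matrix.map_neg _ (fun a => map_neg _ a), UnitaryGroup.reindex_map,
    ← UnitaryGroup.kronecker_map_map, adelicForm_map_snd, adelicForm_map_snd]

/-! ## §2 `ι_v` on the matrix forms -/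

/-- `G₁(F_v) = U(V ⊗ W)(F_v)` in matrix form (index `Fin N × Fin M`). [cite: HarrisKudlaSweet1996, §1 (1.11)] -/
abbrev localPairU : Subgroup (GL (Fin N × Fin M) (UnitaryGroup.LocalRing L v)) :=
  unitaryGroupOfForm (UnitaryGroup.conjLocal L (IsCMField.complexConj L) v) (pairFormLoc L dV dW v)

/-- **`ι_v : G₁(F_v) × G₁(F_v) →* H(F_v)`, `(x₁, x₂) ↦ diag(x₁, x₂)`** on the matrix forms — ★ `iotaGG`'s term over `L_v`.
[cite: HarrisKudlaSweet1996, §1 (1.11)] [cite: Liu2011, §2C p. 863] -/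
def iotaGGLoc : localPairU L dV dW v × localPairU L dV dW v →*
    UnitaryGroup.«local» L (IsCMField.complexConj L) (n + n) (hermD L e dV hdV dW hdW) v :=
  (Subgroup.inclusion (le_of_eq (congrArg (unitaryGroupOfForm (UnitaryGroup.conjLocal L (IsCMField.complexConj L) v))
      (localForm_hermD_eq L e dV hdV dW hdW v).symm))).comp <|
    (UnitaryGroup.reindexU _ (e₂ (n := n)) _).comp <|
      (UnitaryGroup.blockDiag _ _ _).comp <|
        (MonoidHom.prodMap (UnitaryGroup.reindexU _ e _) ((toNegForm _ _).comp (UnitaryGroup.reindexU _ e _)))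

/-- the matrix of `ι_v(x₁, x₂)`: `reindex e₂ (diag (reindex e x₁, reindex e x₂))`. [cite: HarrisKudlaSweet1996, §1 (1.11)] -/
theorem coe_iotaGGLoc (x : localPairU L dV dW v × localPairU L dV dW v) :
    ((iotaGGLoc L e dV hdV dW hdW v x : UnitaryGroup.«local» L (IsCMField.complexConj L) (n + n) (hermD L e dV hdV dW hdW) v) :
        GL (Fin (n + n)) (UnitaryGroup.LocalRing L v)) =
      UnitaryGroup.reindexGL (e₂ (n := n))
        (UnitaryGroup.blockDiagGL (UnitaryGroup.reindexGL e (x.1 : GL (Fin N × Fin M) (UnitaryGroup.LocalRing L v)),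
          UnitaryGroup.reindexGL e (x.2 : GL (Fin N × Fin M) (UnitaryGroup.LocalRing L v)))) :=
  rfl

/-- `ι_v` is continuous. [cite: HarrisKudlaSweet1996, §1 (1.11)] -/
theorem continuous_iotaGGLoc : Continuous (iotaGGLoc L e dV hdV dW hdW v) := by
  refine continuous_induced_rng.2 ?_
  change Continuous fun x => ((iotaGGLoc L e dV hdV dW hdW v x :
    UnitaryGroup.«local» L (IsCMField.complexConj L) (n + n) (hermD L e dV hdV dW hdW) v) :
      GL (Fin (n + n)) (UnitaryGroup.LocalRing L v))
  simp only [coe_iotaGGLoc]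
  exact (UnitaryGroup.continuous_reindexGL _).comp (UnitaryGroup.continuous_blockDiagGL.comp
    (((UnitaryGroup.continuous_reindexGL _).comp (continuous_subtype_val.comp continuous_fst)).prodMk
      ((UnitaryGroup.continuous_reindexGL _).comp (continuous_subtype_val.comp continuous_snd))))

/-- **`ι_v(g₁, g₂) := ι_v(g₁ ⊗ 1, g₂ ⊗ 1)`** on `U(V)(F_v) × U(V)(F_v)` (matrix forms ★ `UnitaryGroup.«local»`; ★ `dualPairInl`).
[cite: HarrisKudlaSweet1996, §1 (1.11)] [cite: Liu2011, §2C p. 863] -/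
def iotaVLoc : UnitaryGroup.«local» L (IsCMField.complexConj L) N (Matrix.diagonal dV) v ×
      UnitaryGroup.«local» L (IsCMField.complexConj L) N (Matrix.diagonal dV) v →*
    UnitaryGroup.«local» L (IsCMField.complexConj L) (n + n) (hermD L e dV hdV dW hdW) v :=
  (iotaGGLoc L e dV hdV dW hdW v).comp
    (MonoidHom.prodMap (UnitaryGroup.dualPairInl _ _ _) (UnitaryGroup.dualPairInl _ _ _))

/-- the matrix of `ι_v(g₁, g₂)`: `reindex e₂ (diag (reindex e (g₁ ⊗ 1), reindex e (g₂ ⊗ 1)))`. [cite: HarrisKudlaSweet1996, §1 (1.11)] -/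
theorem coe_iotaVLoc (g : UnitaryGroup.«local» L (IsCMField.complexConj L) N (Matrix.diagonal dV) v ×
      UnitaryGroup.«local» L (IsCMField.complexConj L) N (Matrix.diagonal dV) v) :
    Units.val (Subtype.val (iotaVLoc L e dV hdV dW hdW v g)) =
      Matrix.reindex (e₂ (n := n)) (e₂ (n := n))
        (Matrix.fromBlocks
          (Matrix.reindex e e (Units.val (Subtype.val g.1) ⊗ₖ (1 : Matrix (Fin M) (Fin M) (UnitaryGroup.LocalRing L v))))
          0 0
          (Matrix.reindex e e (Units.val (Subtype.val g.2) ⊗ₖ (1 : Matrix (Fin M) (Fin M) (UnitaryGroup.LocalRing L v))))) :=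
  rfl

/-- `ι_v` on `U(V)(F_v) × U(V)(F_v)` is continuous. [cite: HarrisKudlaSweet1996, §1 (1.11)] -/
theorem continuous_iotaVLoc : Continuous (iotaVLoc L e dV hdV dW hdW v) :=
  (continuous_iotaGGLoc L e dV hdV dW hdW v).comp
    ((UnitaryGroup.continuous_dualPairInl _ _ _).prodMap (UnitaryGroup.continuous_dualPairInl _ _ _))

/-- **`g ↦ ι_v(g, 1)`** — the argument of the local Siegel section in `Λ_{s,v}(g) = f_{s,v}(ι_v(g, 1))` and in the local zeta
integral `Z_v = ∫ f_v(ι_v(g, 1)) ξ(g) dg`. [cite: Liu2011, §2C p. 863] [cite: Li1992, §3] -/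
def iotaLeftLoc : UnitaryGroup.«local» L (IsCMField.complexConj L) N (Matrix.diagonal dV) v →*
    UnitaryGroup.«local» L (IsCMField.complexConj L) (n + n) (hermD L e dV hdV dW hdW) v :=
  (iotaVLoc L e dV hdV dW hdW v).comp (MonoidHom.inl _ _)

/-- `iotaLeftLoc g = ι_v(g, 1)`. [cite: Liu2011, §2C p. 863] -/
theorem iotaLeftLoc_apply (g : UnitaryGroup.«local» L (IsCMField.complexConj L) N (Matrix.diagonal dV) v) :
    iotaLeftLoc L e dV hdV dW hdW v g = iotaVLoc L e dV hdV dW hdW v (g, 1) :=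
  rfl

/-- `ι_v(g₁, g₂) = ι_v(g₁, 1) · ι_v(1, g₂)`. [cite: Liu2011, §2C p. 863] -/
theorem iotaVLoc_eq_mul (g₁ g₂ : UnitaryGroup.«local» L (IsCMField.complexConj L) N (Matrix.diagonal dV) v) :
    iotaVLoc L e dV hdV dW hdW v (g₁, g₂) = iotaVLoc L e dV hdV dW hdW v (g₁, 1) * iotaVLoc L e dV hdV dW hdW v (1, g₂) := by
  rw [← map_mul, Prod.mk_mul_mk, mul_one, one_mul]

/-! ## §3 Compatibility with the adelic `ι` under `U(·)(𝔸) →* U(·)(F_v)` -/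

/-- the matrix of the adelic `ι(g₁, g₂)` (★ `coe_iotaGG` with ★ `coe_adelicInl`). [cite: Liu2021, §B.3 p. 101] -/
theorem coe_iotaV (g : UnitaryGroup.adelic (Fp L) L (IsCMField.complexConj L) N (Matrix.diagonal dV) ×
      UnitaryGroup.adelic (Fp L) L (IsCMField.complexConj L) N (Matrix.diagonal dV)) :
    (((iotaV L e dV hdV dW hdW g : HA L e dV hdV dW hdW) : GL (Fin (n + n)) (AdeleRing (𝓞 L) L)) :
        Matrix (Fin (n + n)) (Fin (n + n)) (AdeleRing (𝓞 L) L)) =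
      Matrix.reindex (e₂ (n := n)) (e₂ (n := n))
        (Matrix.fromBlocks
          (Matrix.reindex e e (((g.1 : GL (Fin N) (AdeleRing (𝓞 L) L)) : Matrix (Fin N) (Fin N) _) ⊗ₖ
            (1 : Matrix (Fin M) (Fin M) (AdeleRing (𝓞 L) L))))
          0 0
          (Matrix.reindex e e (((g.2 : GL (Fin N) (AdeleRing (𝓞 L) L)) : Matrix (Fin N) (Fin N) _) ⊗ₖ
            (1 : Matrix (Fin M) (Fin M) (AdeleRing (𝓞 L) L))))) :=
  rfl

omit [IsCMField L] in
/-- pushing a ring homomorphism through the block matrix of `ι` (the matrix of `ι` is functorial in the coefficient ring).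
[cite: HarrisKudlaSweet1996, §1 (1.11)] -/
theorem iotaMatrix_map {R S : Type} [CommRing R] [CommRing S] (f : R →+* S)
    (A B : Matrix (Fin N) (Fin N) R) :
    (Matrix.reindex (e₂ (n := n)) (e₂ (n := n))
        (Matrix.fromBlocks (Matrix.reindex e e (A ⊗ₖ (1 : Matrix (Fin M) (Fin M) R))) 0 0
          (Matrix.reindex e e (B ⊗ₖ (1 : Matrix (Fin M) (Fin M) R))))).map f =
      Matrix.reindex (e₂ (n := n)) (e₂ (n := n))
        (Matrix.fromBlocks (Matrix.reindex e e (A.map f ⊗ₖ (1 : Matrix (Fin M) (Fin M) S))) 0 0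
          (Matrix.reindex e e (B.map f ⊗ₖ (1 : Matrix (Fin M) (Fin M) S)))) := by
  rw [UnitaryGroup.reindex_map, Matrix.fromBlocks_map, UnitaryGroup.reindex_map, UnitaryGroup.reindex_map,
    Matrix.map_zero _ (map_zero _), ← UnitaryGroup.kronecker_map_map, ← UnitaryGroup.kronecker_map_map,
    Matrix.map_one _ (map_zero _) (map_one _)]

/-- **`(ι(g₁, g₂))_v = ι_v((g₁)_v, (g₂)_v)`**: the adelic doubling embedding followed by ★ `UnitaryGroup.toLocal v` is the local
one on the local components. [cite: Liu2011, §2C p. 863] [cite: HarrisKudlaSweet1996, §1 (1.11)] -/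
theorem toLocal_iotaV (g₁ g₂ : UnitaryGroup.adelic (Fp L) L (IsCMField.complexConj L) N (Matrix.diagonal dV)) :
    UnitaryGroup.toLocal L (IsCMField.complexConj L) (n + n) (hermD L e dV hdV dW hdW) v (iotaV L e dV hdV dW hdW (g₁, g₂)) =
      iotaVLoc L e dV hdV dW hdW v
        (UnitaryGroup.toLocal L (IsCMField.complexConj L) N (Matrix.diagonal dV) v g₁,
          UnitaryGroup.toLocal L (IsCMField.complexConj L) N (Matrix.diagonal dV) v g₂) := by
  refine Subtype.ext (Units.ext ?_)
  change ((((iotaV L e dV hdV dW hdW (g₁, g₂) : HA L e dV hdV dW hdW) : GL (Fin (n + n)) (AdeleRing (𝓞 L) L)) :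
      Matrix (Fin (n + n)) (Fin (n + n)) (AdeleRing (𝓞 L) L))).map (UnitaryGroup.adeleToLocal L v) = _
  rw [coe_iotaV, iotaMatrix_map]
  rfl

/-! ## §4 The factor forms `localPi` -/

/-- **`ι_v : localPi N (diag dV) v × localPi N (diag dV) v →* localPi (n + n) J^𝔻 v`** (through ★ `localPiEquiv`) — the local
doubling embedding on the restricted-product factors. [cite: Liu2011, §2C p. 863] [cite: HarrisKudlaSweet1996, §1 (1.11)] -/
def iotaVLocPi : UnitaryGroup.localPi L (IsCMField.complexConj L) N (Matrix.diagonal dV) v ×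
      UnitaryGroup.localPi L (IsCMField.complexConj L) N (Matrix.diagonal dV) v →*
    UnitaryGroup.localPi L (IsCMField.complexConj L) (n + n) (hermD L e dV hdV dW hdW) v :=
  ((UnitaryGroup.localPiEquiv L (IsCMField.complexConj L) (n + n) (hermD L e dV hdV dW hdW) v).symm.toMonoidHom.comp
      (iotaVLoc L e dV hdV dW hdW v)).comp
    (MonoidHom.prodMap (UnitaryGroup.localPiEquiv L (IsCMField.complexConj L) N (Matrix.diagonal dV) v).toMonoidHom
      (UnitaryGroup.localPiEquiv L (IsCMField.complexConj L) N (Matrix.diagonal dV) v).toMonoidHom)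

/-- unfolding: `localPiEquiv (ι_v x) = ι_v (localPiEquiv x.1, localPiEquiv x.2)`. [cite: Liu2011, §2C p. 863] -/
theorem localPiEquiv_iotaVLocPi (x : UnitaryGroup.localPi L (IsCMField.complexConj L) N (Matrix.diagonal dV) v ×
      UnitaryGroup.localPi L (IsCMField.complexConj L) N (Matrix.diagonal dV) v) :
    UnitaryGroup.localPiEquiv L (IsCMField.complexConj L) (n + n) (hermD L e dV hdV dW hdW) v (iotaVLocPi L e dV hdV dW hdW v x) =
      iotaVLoc L e dV hdV dW hdW v
        (UnitaryGroup.localPiEquiv L (IsCMField.complexConj L) N (Matrix.diagonal dV) v x.1,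
          UnitaryGroup.localPiEquiv L (IsCMField.complexConj L) N (Matrix.diagonal dV) v x.2) :=
  (UnitaryGroup.localPiEquiv L (IsCMField.complexConj L) (n + n) (hermD L e dV hdV dW hdW) v).apply_symm_apply _

/-- `ι_v` on the factor forms is continuous. [cite: Liu2011, §2C p. 863] -/
theorem continuous_iotaVLocPi : Continuous (iotaVLocPi L e dV hdV dW hdW v) :=
  ((UnitaryGroup.localPiEquiv L (IsCMField.complexConj L) (n + n) (hermD L e dV hdV dW hdW) v).symm.continuous.comp
      (continuous_iotaVLoc L e dV hdV dW hdW v)).comp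
    ((UnitaryGroup.localPiEquiv L (IsCMField.complexConj L) N (Matrix.diagonal dV) v).continuous.prodMap
      (UnitaryGroup.localPiEquiv L (IsCMField.complexConj L) N (Matrix.diagonal dV) v).continuous)

/-- **`g ↦ ι_v(g, 1)` on the factor forms** — the argument of `Λ_{s,v}` and of the local zeta integral.
[cite: Liu2011, §2C p. 863] [cite: Li1992, §3] -/
def iotaLeftLocPi : UnitaryGroup.localPi L (IsCMField.complexConj L) N (Matrix.diagonal dV) v →*
    UnitaryGroup.localPi L (IsCMField.complexConj L) (n + n) (hermD L e dV hdV dW hdW) v :=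
  (iotaVLocPi L e dV hdV dW hdW v).comp (MonoidHom.inl _ _)

/-- `iotaLeftLocPi g = ι_v(g, 1)`. [cite: Liu2011, §2C p. 863] -/
theorem iotaLeftLocPi_apply (g : UnitaryGroup.localPi L (IsCMField.complexConj L) N (Matrix.diagonal dV) v) :
    iotaLeftLocPi L e dV hdV dW hdW v g = iotaVLocPi L e dV hdV dW hdW v (g, 1) :=
  rfl

/-- `g ↦ ι_v(g, 1)` on the factor forms is continuous. [cite: Liu2011, §2C p. 863] -/
theorem continuous_iotaLeftLocPi : Continuous (iotaLeftLocPi L e dV hdV dW hdW v) :=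
  (continuous_iotaVLocPi L e dV hdV dW hdW v).comp (continuous_id.prodMk continuous_const)


/-! ## §5 The finite-adelic `ι_f` and the place-by-place bookkeeping -/

/-- `G₁(𝔸_f) = U(V ⊗ W)(𝔸_{L⁺,f})` in matrix form (index `Fin N × Fin M`). [cite: HarrisKudlaSweet1996, §1 (1.11)] -/
abbrev finPairU : Subgroup (GL (Fin N × Fin M) (FiniteAdeleRing (𝓞 L) L)) :=
  unitaryGroupOfForm (UnitaryGroup.conjFiniteAdele (Fp L) L (IsCMField.complexConj L)) (pairFormFin L dV dW)

/-- **`ι_f : G₁(𝔸_f) × G₁(𝔸_f) →* H(𝔸_f)`** on the matrix forms (★ `UnitaryGroup.finAdelic`) — ★ `iotaGG`'s term over `𝔸_{L,f}`.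
[cite: HarrisKudlaSweet1996, §1 (1.11)] -/
def iotaGGFin : finPairU L dV dW × finPairU L dV dW →*
    UnitaryGroup.finAdelic (Fp L) L (IsCMField.complexConj L) (n + n) (hermD L e dV hdV dW hdW) :=
  (Subgroup.inclusion (le_of_eq (congrArg (unitaryGroupOfForm (UnitaryGroup.conjFiniteAdele (Fp L) L (IsCMField.complexConj L)))
      (finiteAdelicForm_hermD_eq L e dV hdV dW hdW).symm))).comp <|
    (UnitaryGroup.reindexU _ (e₂ (n := n)) _).comp <|
      (UnitaryGroup.blockDiag _ _ _).comp <|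
        (MonoidHom.prodMap (UnitaryGroup.reindexU _ e _) ((toNegForm _ _).comp (UnitaryGroup.reindexU _ e _)))

/-- **`ι_f(g₁, g₂) := ι_f(g₁ ⊗ 1, g₂ ⊗ 1)`** on `U(V)(𝔸_f) × U(V)(𝔸_f)`. [cite: HarrisKudlaSweet1996, §1 (1.11)] [cite: Liu2011, §2C p. 863] -/
def iotaVFin : UnitaryGroup.finAdelic (Fp L) L (IsCMField.complexConj L) N (Matrix.diagonal dV) ×
      UnitaryGroup.finAdelic (Fp L) L (IsCMField.complexConj L) N (Matrix.diagonal dV) →*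
    UnitaryGroup.finAdelic (Fp L) L (IsCMField.complexConj L) (n + n) (hermD L e dV hdV dW hdW) :=
  (iotaGGFin L e dV hdV dW hdW).comp
    (MonoidHom.prodMap (UnitaryGroup.dualPairInl _ _ _) (UnitaryGroup.dualPairInl _ _ _))

/-- the matrix of `ι_f(g₁, g₂)`. [cite: HarrisKudlaSweet1996, §1 (1.11)] -/
theorem coe_iotaVFin (g : UnitaryGroup.finAdelic (Fp L) L (IsCMField.complexConj L) N (Matrix.diagonal dV) ×
      UnitaryGroup.finAdelic (Fp L) L (IsCMField.complexConj L) N (Matrix.diagonal dV)) :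
    Units.val (Subtype.val (iotaVFin L e dV hdV dW hdW g)) =
      Matrix.reindex (e₂ (n := n)) (e₂ (n := n))
        (Matrix.fromBlocks
          (Matrix.reindex e e (Units.val (Subtype.val g.1) ⊗ₖ (1 : Matrix (Fin M) (Fin M) (FiniteAdeleRing (𝓞 L) L))))
          0 0
          (Matrix.reindex e e (Units.val (Subtype.val g.2) ⊗ₖ (1 : Matrix (Fin M) (Fin M) (FiniteAdeleRing (𝓞 L) L))))) :=
  rfl

/-- `ι_f` is continuous. [cite: HarrisKudlaSweet1996, §1 (1.11)] -/
theorem continuous_iotaVFin : Continuous (iotaVFin L e dV hdV dW hdW) := by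
  refine continuous_induced_rng.2 ?_
  change Continuous fun x => Subtype.val (iotaVFin L e dV hdV dW hdW x)
  have h : (fun x => Subtype.val (iotaVFin L e dV hdV dW hdW x)) = fun x =>
      UnitaryGroup.reindexGL (e₂ (n := n))
        (UnitaryGroup.blockDiagGL
          (UnitaryGroup.reindexGL e (UnitaryGroup.kroneckerGL (Subtype.val x.1, (1 : GL (Fin M) (FiniteAdeleRing (𝓞 L) L)))),
            UnitaryGroup.reindexGL e (UnitaryGroup.kroneckerGL (Subtype.val x.2, (1 : GL (Fin M) (FiniteAdeleRing (𝓞 L) L)))))) :=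
    rfl
  rw [h]
  exact (UnitaryGroup.continuous_reindexGL _).comp (UnitaryGroup.continuous_blockDiagGL.comp
    (((UnitaryGroup.continuous_reindexGL _).comp (UnitaryGroup.continuous_kroneckerGL.comp
        ((continuous_subtype_val.comp continuous_fst).prodMk continuous_const))).prodMk
      ((UnitaryGroup.continuous_reindexGL _).comp (UnitaryGroup.continuous_kroneckerGL.comp
        ((continuous_subtype_val.comp continuous_snd).prodMk continuous_const)))))

/-- **`g ↦ ι_f(g, 1)`** on `U(V)(𝔸_f)`. [cite: Liu2011, §2C p. 863] -/
def iotaLeftFin : UnitaryGroup.finAdelic (Fp L) L (IsCMField.complexConj L) N (Matrix.diagonal dV) →*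
    UnitaryGroup.finAdelic (Fp L) L (IsCMField.complexConj L) (n + n) (hermD L e dV hdV dW hdW) :=
  (iotaVFin L e dV hdV dW hdW).comp (MonoidHom.inl _ _)

/-- `iotaLeftFin g = ι_f(g, 1)`. [cite: Liu2011, §2C p. 863] -/
theorem iotaLeftFin_apply (g : UnitaryGroup.finAdelic (Fp L) L (IsCMField.complexConj L) N (Matrix.diagonal dV)) :
    iotaLeftFin L e dV hdV dW hdW g = iotaVFin L e dV hdV dW hdW (g, 1) :=
  rfl

/-- **`(ι(g₁, g₂))_f = ι_f((g₁)_f, (g₂)_f)`** (★ `UnitaryGroup.finPart`). [cite: HarrisKudlaSweet1996, §1 (1.11)] [cite: Liu2011, §2C p. 863] -/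
theorem finPart_iotaV (g₁ g₂ : UnitaryGroup.adelic (Fp L) L (IsCMField.complexConj L) N (Matrix.diagonal dV)) :
    UnitaryGroup.finPart (Fp L) L (IsCMField.complexConj L) (n + n) (hermD L e dV hdV dW hdW) (iotaV L e dV hdV dW hdW (g₁, g₂)) =
      iotaVFin L e dV hdV dW hdW
        (UnitaryGroup.finPart (Fp L) L (IsCMField.complexConj L) N (Matrix.diagonal dV) g₁,
          UnitaryGroup.finPart (Fp L) L (IsCMField.complexConj L) N (Matrix.diagonal dV) g₂) := by
  refine Subtype.ext (Units.ext ?_)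
  change ((((iotaV L e dV hdV dW hdW (g₁, g₂) : HA L e dV hdV dW hdW) : GL (Fin (n + n)) (AdeleRing (𝓞 L) L)) :
      Matrix (Fin (n + n)) (Fin (n + n)) (AdeleRing (𝓞 L) L))).map (UnitaryGroup.adeleSnd L) = _
  rw [coe_iotaV, iotaMatrix_map]
  rfl

/-- the matrix of `localPiEquiv (g_v)` is `g` read through ★ `finiteAdeleToLocal` (entrywise definitional).
[cite: PlatonovRapinchuk1994, §5.1] -/
theorem coe_localPiEquiv_evalPlace_eq_map {K : ℕ} (J : Matrix (Fin K) (Fin K) L)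
    (g : UnitaryGroup.finAdelic (Fp L) L (IsCMField.complexConj L) K J) :
    Units.val (Subtype.val (UnitaryGroup.localPiEquiv L (IsCMField.complexConj L) K J v
        (UnitaryGroup.evalPlace (Fp L) L (IsCMField.complexConj L) K J v g))) =
      (Units.val (Subtype.val g)).map (UnitaryGroup.finiteAdeleToLocal L v) :=
  Matrix.ext fun _ _ => funext fun _ => rfl

set_option maxHeartbeats 400000 in
/-- **`(ι_f(h₁, h₂))_v = ι_v((h₁)_v, (h₂)_v)`** on the restricted-product factors (★ `UnitaryGroup.evalPlace`): the doubling
embedding is computed place by place — the bookkeeping behind `Z(s) = (∏_{v∉S} c_v(s))·Z_S(s)`.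
[cite: Liu2011, §2C p. 863] [cite: HarrisKudlaSweet1996, §1 (1.11)] -/
theorem evalPlace_iotaVFin (h₁ h₂ : UnitaryGroup.finAdelic (Fp L) L (IsCMField.complexConj L) N (Matrix.diagonal dV)) :
    UnitaryGroup.evalPlace (Fp L) L (IsCMField.complexConj L) (n + n) (hermD L e dV hdV dW hdW) v
        (iotaVFin L e dV hdV dW hdW (h₁, h₂)) =
      iotaVLocPi L e dV hdV dW hdW v
        (UnitaryGroup.evalPlace (Fp L) L (IsCMField.complexConj L) N (Matrix.diagonal dV) v h₁,
          UnitaryGroup.evalPlace (Fp L) L (IsCMField.complexConj L) N (Matrix.diagonal dV) v h₂) := by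
  apply (UnitaryGroup.localPiEquiv L (IsCMField.complexConj L) (n + n) (hermD L e dV hdV dW hdW) v).injective
  rw [localPiEquiv_iotaVLocPi]
  refine Subtype.ext (Units.ext ?_)
  rw [coe_localPiEquiv_evalPlace_eq_map, coe_iotaVFin, iotaMatrix_map, coe_iotaVLoc, coe_localPiEquiv_evalPlace_eq_map,
    coe_localPiEquiv_evalPlace_eq_map]

/-- **`(ι_f(h, 1))_v = ι_v(h_v, 1)`**. [cite: Liu2011, §2C p. 863] -/
theorem evalPlace_iotaLeftFin (h : UnitaryGroup.finAdelic (Fp L) L (IsCMField.complexConj L) N (Matrix.diagonal dV)) :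
    UnitaryGroup.evalPlace (Fp L) L (IsCMField.complexConj L) (n + n) (hermD L e dV hdV dW hdW) v
        (iotaLeftFin L e dV hdV dW hdW h) =
      iotaLeftLocPi L e dV hdV dW hdW v (UnitaryGroup.evalPlace (Fp L) L (IsCMField.complexConj L) N (Matrix.diagonal dV) v h) := by
  rw [iotaLeftFin_apply, evalPlace_iotaVFin, map_one, iotaLeftLocPi_apply]

end Literature.NumberTheory.K2Lit.SiegelDoubled

end
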